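import Summits.Ventures.PercRepro.S4MaxFlatEightReduction

/-!
# PercRepro — THE LEVEL-7 ROW `p = 11` WITH A MAXIMAL RANK-`8` FLAT REDUCES TO C-025 AT `(8, 6)` ON THE FLAT (p7 g23; the row-10
reduction S4MaxFlatEightReduction one rank up: `|E ∖ F| = 4`, `M/F = U(3,4)`)

Let `M` be a coloop-free matroid of rank `11` and `F ⊆ E` a rank-`8` set with `|E ∖ F| = 4`. Writing `S = A ⊔ T` (`A = S ∩ F`,
`T = S ∩ X`, `X = E ∖ F`): a `U(11, 7)`-set has `|T| = 3` and `A ∈ U(8, 6)` of `M ↾ F` (four `T` per `A`), or `T = X` and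
`ρ(F ∖ A) = 7` with `ρ(A) ∈ {7, 8}`; the sets `A ∪ T` with `(ρ(A), |T|) ∈ {(8, 0), (7, 1), (8, 1), (7, 2), (8, 2)}` are distinct
`Y(11, 7)`-sets (`C(4, j) = 1, 4, 6`). With `Φ(11, 7) = 77/18` and `Φ(8, 6) = 8/7` on `M ↾ F`: `#U ≤ 4u + v₈ + v₇`,
`#Y ≥ 11 w₈ + 10 w₇`, `u + v₈ ≤ w₈`, `v₇ ≤ w₇`, `(8/7) u ≤ w₇` ⟹ `77/18 · #U ≤ #Y`. Nothing else is claimed.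

* **`s7lp_11_of_maxflat8`**, **`s7lp_11_of_maxflat8'`**.
Axioms: standard.
-/

open scoped Matroid

namespace PercRepro

namespace S4Ups

open Set Finset S2LP S3LP S3MF

variable {α : Type} {M : Matroid α} [M.Finite]

section Reduction

variable (hM : M.eRank = ((11 : ℕ) : ℕ∞)) (hcol : M.coloops = ∅) {F : Set α} (hF : F ⊆ M.E)
  (hFr : M.eRk F = ((8 : ℕ) : ℕ∞)) (hFn : F.ncard + 4 = M.E.ncard)
include hM hcol hF hFr hFn

set_option maxHeartbeats 4000000 in
/-- **THE ROW `p = 11` OF LEVEL `7` WITH A MAXIMAL RANK-`8` FLAT**: if `F ⊆ E` has rank `8` and `|E ∖ F| = 4` in a coloop-free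
matroid of rank `11`, then `77/18 · #U(11, 7) ≤ #Y(11, 7)` follows from C-025 at `(8, 6)` on `M ↾ F`. -/
theorem s7lp_11_of_maxflat8 [(M ↾ F).Finite] (hrls : ThmN.RLS (M ↾ F) 8 6) :
    (77 / 18 : ℚ) * (Matroid.topCount M 11 7 : ℚ) ≤ (Matroid.midCount M 11 7 : ℚ) := by
  have hFn' : F.ncard + (11 - 8 + 1) = M.E.ncard := by norm_num; exact hFn
  have hX3 : (M.E \ F).ncard = 4 := by
    have h := ncard_sdiff_add_ncard_of_subset hF M.ground_finite
    omega
  have hXfin : (M.E \ F).Finite := M.ground_finite.subset sdiff_subset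
  have hFfin : F.Finite := M.ground_finite.subset hF
  have hPfin : {A : Set α | A ⊆ F}.Finite := hFfin.finite_subsets
  -- rank additivity for `A ⊆ F`, `T ⊊ X`
  have radd : ∀ {A T : Set α}, A ⊆ F → T ⊆ M.E \ F → T ≠ M.E \ F → ∀ {r : ℕ}, M.eRk A = (r : ℕ∞) →
      M.eRk (A ∪ T) = ((r + T.ncard : ℕ) : ℕ∞) :=
    fun {_ _} hA hT hTne {_} hAr => eRk_union_eq_add hM hcol hF hFr (by norm_num) hFn' hA hT hTne hAr
  have hne_of_lt : ∀ {T : Set α}, T ⊆ M.E \ F → T.ncard < 4 → T ≠ M.E \ F := by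
    intro T _ hT3 hTX
    rw [hTX, hX3] at hT3
    omega
  -- the rank of a subset of `F` is at most `8`, and finite
  have hrkF : ∀ {A : Set α}, A ⊆ F → ∃ r : ℕ, M.eRk A = (r : ℕ∞) ∧ r ≤ 8 := by
    intro A hA
    have hle : M.eRk A ≤ ((8 : ℕ) : ℕ∞) := by rw [← hFr]; exact M.eRk_mono hA
    have hfin : M.eRk A ≠ ⊤ := ne_top_of_le_ne_top (ENat.coe_ne_top 8) hle
    obtain ⟨r, hr⟩ := ENat.ne_top_iff_exists.mp hfin
    refine ⟨r, hr.symm, ?_⟩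
    rw [← hr] at hle
    exact_mod_cast hle
  -- the families
  set W8 := {A : Set α | A ⊆ F ∧ M.eRk A = ((8 : ℕ) : ℕ∞)} with hW8
  set W7 := {A : Set α | A ⊆ F ∧ M.eRk A = ((7 : ℕ) : ℕ∞)} with hW7
  set UF := {A : Set α | A ⊆ F ∧ M.eRk A = ((8 : ℕ) : ℕ∞) ∧ M.eRk (F \ A) = ((6 : ℕ) : ℕ∞)} with hUF
  set V8 := {A : Set α | A ⊆ F ∧ M.eRk A = ((8 : ℕ) : ℕ∞) ∧ M.eRk (F \ A) = ((7 : ℕ) : ℕ∞)} with hV8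
  set V7 := {A : Set α | A ⊆ F ∧ M.eRk A = ((7 : ℕ) : ℕ∞) ∧ M.eRk (F \ A) = ((7 : ℕ) : ℕ∞)} with hV7
  have hW8fin : W8.Finite := hPfin.subset (fun _ h => h.1)
  have hW7fin : W7.Finite := hPfin.subset (fun _ h => h.1)
  have hUFfin : UF.Finite := hPfin.subset (fun _ h => h.1)
  have hV8fin : V8.Finite := hPfin.subset (fun _ h => h.1)
  have hV7fin : V7.Finite := hPfin.subset (fun _ h => h.1)
  -- (1) the `U`-side: `#U ≤ 3 #UF + #V8 + #V7`
  have hU : Matroid.topCount M 11 7 ≤ 4 * UF.ncard + V8.ncard + V7.ncard := by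
    unfold Matroid.topCount
    obtain ⟨I1, hI1⟩ : ∃ I : Set (Set α), I = (fun P : Set α × Set α => P.1 ∪ P.2) ''
      (UF ×ˢ {T : Set α | T ⊆ M.E \ F ∧ T.ncard = 3}) := ⟨_, rfl⟩
    obtain ⟨I2, hI2⟩ : ∃ I : Set (Set α), I = (fun P : Set α × Set α => P.1 ∪ P.2) ''
      (V8 ×ˢ {T : Set α | T ⊆ M.E \ F ∧ T.ncard = 4}) := ⟨_, rfl⟩
    obtain ⟨I3, hI3⟩ : ∃ I : Set (Set α), I = (fun P : Set α × Set α => P.1 ∪ P.2) ''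
      (V7 ×ˢ {T : Set α | T ⊆ M.E \ F ∧ T.ncard = 4}) := ⟨_, rfl⟩
    have hsub : {A : Set α | A ⊆ M.E ∧ M.eRk A = ((11 : ℕ) : ℕ∞) ∧ M.eRk (M.E \ A) = ((7 : ℕ) : ℕ∞)} ⊆
        I1 ∪ (I2 ∪ I3) := by
      rw [hI1, hI2, hI3]
      rintro S ⟨hSE, hS10, hS7⟩
      have hdec := union_inter_eq_of_subset (M := M) (F := F) hSE
      have hAF : S ∩ F ⊆ F := inter_subset_right
      have hTX : S ∩ (M.E \ F) ⊆ M.E \ F := inter_subset_right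
      obtain ⟨r, hr, hr8⟩ := hrkF hAF
      have hT3 : (S ∩ (M.E \ F)).ncard ≤ 4 := by rw [← hX3]; exact ncard_le_ncard hTX hXfin
      rcases Nat.lt_or_ge (S ∩ (M.E \ F)).ncard 4 with hlt | hge
      · -- `T ⊊ X`: rank additivity on `S` and on `E ∖ S`
        have hTne := hne_of_lt hTX hlt
        have h1 := radd hAF hTX hTne hr
        rw [hdec, hS10] at h1
        have h1' : 11 = r + (S ∩ (M.E \ F)).ncard := by exact_mod_cast h1
        have hr8' : r = 8 := by omega
        have hT2 : (S ∩ (M.E \ F)).ncard = 3 := by omega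
        -- the complement
        have hcomp : M.E \ S = (F \ (S ∩ F)) ∪ ((M.E \ F) \ (S ∩ (M.E \ F))) := by
          conv_lhs => rw [← hdec]
          exact sdiff_union_eq_of_subset hF hAF hTX
        have hT'X : (M.E \ F) \ (S ∩ (M.E \ F)) ⊆ M.E \ F := sdiff_subset
        have hT'1 : ((M.E \ F) \ (S ∩ (M.E \ F))).ncard = 1 := by
          rw [ncard_sdiff' hTX hXfin, hX3, hT2]
        have hT'ne := hne_of_lt hT'X (by omega)
        obtain ⟨r', hr', -⟩ := hrkF (sdiff_subset : F \ (S ∩ F) ⊆ F)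
        have h2 := radd (sdiff_subset : F \ (S ∩ F) ⊆ F) hT'X hT'ne hr'
        rw [← hcomp, hS7, hT'1] at h2
        have h2' : 7 = r' + 1 := by exact_mod_cast h2
        left
        refine ⟨⟨S ∩ F, S ∩ (M.E \ F)⟩, ⟨⟨hAF, ?_, ?_⟩, hTX, hT2⟩, hdec⟩
        · rw [hr, hr8']
        · rw [hr']; congr 1; omega
      · -- `T = X`: the complement is `F ∖ A`
        have hTX' : S ∩ (M.E \ F) = M.E \ F := eq_of_subset_of_ncard_le hTX (by omega) hXfin
        have hcomp : M.E \ S = F \ (S ∩ F) := by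
          conv_lhs => rw [← hdec]
          rw [sdiff_union_eq_of_subset hF hAF hTX, hTX', Set.sdiff_self, union_empty]
        rw [hcomp] at hS7
        -- `ρ(A) ≥ 7` from `10 = ρ(A ∪ X) ≤ ρ(A) + |X|`
        have hup : M.eRk S ≤ M.eRk (S ∩ F) + M.eRk (S ∩ (M.E \ F)) := by
          conv_lhs => rw [← hdec]
          exact M.eRk_union_le_eRk_add_eRk _ _
        have hXr : M.eRk (S ∩ (M.E \ F)) ≤ ((4 : ℕ) : ℕ∞) := by
          rw [hTX']
          calc M.eRk (M.E \ F) ≤ (M.E \ F).encard := M.eRk_le_encard _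
            _ = ((4 : ℕ) : ℕ∞) := by rw [← hXfin.cast_ncard_eq, hX3]
        rw [hS10, hr] at hup
        have hup' : M.eRk S ≤ ((r + 4 : ℕ) : ℕ∞) := by
          rw [hS10]
          calc ((11 : ℕ) : ℕ∞) ≤ (r : ℕ∞) + M.eRk (S ∩ (M.E \ F)) := hup
            _ ≤ (r : ℕ∞) + ((4 : ℕ) : ℕ∞) := add_le_add le_rfl hXr
            _ = ((r + 4 : ℕ) : ℕ∞) := by push_cast; rfl
        rw [hS10] at hup'
        have hr7 : 7 ≤ r := by
          have : (11 : ℕ) ≤ r + 4 := by exact_mod_cast hup'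
          omega
        right
        rcases Nat.eq_or_lt_of_le hr7 with h7 | h8
        · right
          refine ⟨⟨S ∩ F, S ∩ (M.E \ F)⟩, ⟨⟨hAF, ?_, hS7⟩, hTX, le_antisymm hT3 hge⟩, hdec⟩
          rw [hr, ← h7]
        · left
          refine ⟨⟨S ∩ F, S ∩ (M.E \ F)⟩, ⟨⟨hAF, ?_, hS7⟩, hTX, le_antisymm hT3 hge⟩, hdec⟩
          rw [hr]; congr 1; omega
    have hfin1 : I1.Finite := by
      rw [hI1]; exact (hUFfin.prod (hXfin.finite_subsets.subset (fun _ h => h.1))).image _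
    have hfin2 : I2.Finite := by
      rw [hI2]; exact (hV8fin.prod (hXfin.finite_subsets.subset (fun _ h => h.1))).image _
    have hfin3 : I3.Finite := by
      rw [hI3]; exact (hV7fin.prod (hXfin.finite_subsets.subset (fun _ h => h.1))).image _
    have hc1 : I1.ncard ≤ UF.ncard * Nat.choose (M.E \ F).ncard 3 := by
      rw [hI1]; exact ncard_glue_le UF (fun _ h => h.1) 3
    have hc2 : I2.ncard ≤ V8.ncard * Nat.choose (M.E \ F).ncard 4 := by
      rw [hI2]; exact ncard_glue_le V8 (fun _ h => h.1) 4
    have hc3 : I3.ncard ≤ V7.ncard * Nat.choose (M.E \ F).ncard 4 := by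
      rw [hI3]; exact ncard_glue_le V7 (fun _ h => h.1) 4
    rw [hX3, show Nat.choose 4 3 = 4 by decide] at hc1
    rw [hX3, show Nat.choose 4 4 = 1 by decide] at hc2 hc3
    have h1 := ncard_le_ncard hsub (hfin1.union (hfin2.union hfin3))
    have h2 := ncard_union_le I1 (I2 ∪ I3)
    have h3 := ncard_union_le I2 I3
    omega
  -- (2) the `Y`-side: `#Y ≥ 4 #W8 + 6 #W7`
  have hY : 11 * W8.ncard + 10 * W7.ncard ≤ Matroid.midCount M 11 7 := by
    unfold Matroid.midCount
    -- the four glued families, all inside `Y`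
    have hglueY : ∀ (r j : ℕ), 7 < r + j → r + j < 11 → j < 4 →
        (fun P : Set α × Set α => P.1 ∪ P.2) ''
            ({A : Set α | A ⊆ F ∧ M.eRk A = (r : ℕ∞)} ×ˢ {T : Set α | T ⊆ M.E \ F ∧ T.ncard = j}) ⊆
          {A : Set α | A ⊆ M.E ∧ ((7 : ℕ) : ℕ∞) < M.eRk A ∧ M.eRk A < ((11 : ℕ) : ℕ∞)} := by
      intro r j h1 h2 hj
      rintro S ⟨⟨A, T⟩, ⟨hA, hT⟩, rfl⟩
      simp only [mem_setOf_eq] at hA hT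
      have hTne : T ≠ M.E \ F := hne_of_lt hT.1 (by omega)
      have hrk := radd hA.1 hT.1 hTne hA.2
      simp only
      refine ⟨union_subset (hA.1.trans hF) (hT.1.trans sdiff_subset), ?_, ?_⟩
      · rw [hrk, hT.2]; exact_mod_cast h1
      · rw [hrk, hT.2]; exact_mod_cast h2
    obtain ⟨G80, hG80⟩ : ∃ G : Set (Set α), G = (fun P : Set α × Set α => P.1 ∪ P.2) ''
      (W8 ×ˢ {T : Set α | T ⊆ M.E \ F ∧ T.ncard = 0}) := ⟨_, rfl⟩
    obtain ⟨G71, hG71⟩ : ∃ G : Set (Set α), G = (fun P : Set α × Set α => P.1 ∪ P.2) ''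
      (W7 ×ˢ {T : Set α | T ⊆ M.E \ F ∧ T.ncard = 1}) := ⟨_, rfl⟩
    obtain ⟨G81, hG81⟩ : ∃ G : Set (Set α), G = (fun P : Set α × Set α => P.1 ∪ P.2) ''
      (W8 ×ˢ {T : Set α | T ⊆ M.E \ F ∧ T.ncard = 1}) := ⟨_, rfl⟩
    obtain ⟨G72, hG72⟩ : ∃ G : Set (Set α), G = (fun P : Set α × Set α => P.1 ∪ P.2) ''
      (W7 ×ˢ {T : Set α | T ⊆ M.E \ F ∧ T.ncard = 2}) := ⟨_, rfl⟩
    obtain ⟨G82, hG82⟩ : ∃ G : Set (Set α), G = (fun P : Set α × Set α => P.1 ∪ P.2) ''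
      (W8 ×ˢ {T : Set α | T ⊆ M.E \ F ∧ T.ncard = 2}) := ⟨_, rfl⟩
    have hsub : G80 ∪ G71 ∪ G81 ∪ G72 ∪ G82 ⊆
        {A : Set α | A ⊆ M.E ∧ ((7 : ℕ) : ℕ∞) < M.eRk A ∧ M.eRk A < ((11 : ℕ) : ℕ∞)} := by
      rw [hG80, hG71, hG81, hG72, hG82]
      refine union_subset (union_subset (union_subset (union_subset ?_ ?_) ?_) ?_) ?_
      · exact hglueY 8 0 (by norm_num) (by norm_num) (by norm_num)
      · exact hglueY 7 1 (by norm_num) (by norm_num) (by norm_num)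
      · exact hglueY 8 1 (by norm_num) (by norm_num) (by norm_num)
      · exact hglueY 7 2 (by norm_num) (by norm_num) (by norm_num)
      · exact hglueY 8 2 (by norm_num) (by norm_num) (by norm_num)
    have hYfin : {A : Set α | A ⊆ M.E ∧ ((7 : ℕ) : ℕ∞) < M.eRk A ∧ M.eRk A < ((11 : ℕ) : ℕ∞)}.Finite :=
      M.ground_finite.finite_subsets.subset (fun _ h => h.1)
    have hd1 : Disjoint G80 G71 := by
      rw [hG80, hG71]; exact glue_disjoint_of_ne (M := M) (Or.inr (by norm_num))
    have hd2 : Disjoint (G80 ∪ G71) G81 := by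
      rw [hG80, hG71, hG81, Set.disjoint_union_left]
      exact ⟨glue_disjoint_of_ne (M := M) (Or.inr (by norm_num)), glue_disjoint_of_ne (M := M) (Or.inl (by norm_num))⟩
    have hd3 : Disjoint (G80 ∪ G71 ∪ G81) G72 := by
      rw [hG80, hG71, hG81, hG72, Set.disjoint_union_left, Set.disjoint_union_left]
      exact ⟨⟨glue_disjoint_of_ne (M := M) (Or.inr (by norm_num)), glue_disjoint_of_ne (M := M) (Or.inr (by norm_num))⟩,
        glue_disjoint_of_ne (M := M) (Or.inr (by norm_num))⟩
    have hd4 : Disjoint (G80 ∪ G71 ∪ G81 ∪ G72) G82 := by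
      rw [hG80, hG71, hG81, hG72, hG82, Set.disjoint_union_left, Set.disjoint_union_left, Set.disjoint_union_left]
      exact ⟨⟨⟨glue_disjoint_of_ne (M := M) (Or.inr (by norm_num)), glue_disjoint_of_ne (M := M) (Or.inr (by norm_num))⟩,
        glue_disjoint_of_ne (M := M) (Or.inr (by norm_num))⟩, glue_disjoint_of_ne (M := M) (Or.inl (by norm_num))⟩
    have hfinU : (G80 ∪ G71 ∪ G81 ∪ G72 ∪ G82).Finite := hYfin.subset hsub
    have hfinA' : (G80 ∪ G71 ∪ G81 ∪ G72).Finite := hfinU.subset subset_union_left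
    have hfinA : (G80 ∪ G71 ∪ G81).Finite := hfinA'.subset subset_union_left
    have hfinB : (G80 ∪ G71).Finite := hfinA.subset subset_union_left
    have hcount : (G80 ∪ G71 ∪ G81 ∪ G72 ∪ G82).ncard = 11 * W8.ncard + 10 * W7.ncard := by
      rw [ncard_union_eq hd4 hfinA' (hfinU.subset subset_union_right),
        ncard_union_eq hd3 hfinA (hfinA'.subset subset_union_right),
        ncard_union_eq hd2 hfinB (hfinA.subset subset_union_right),
        ncard_union_eq hd1 (hfinB.subset subset_union_left) (hfinB.subset subset_union_right),
        hG80, hG71, hG81, hG72, hG82, ncard_glue_eq W8 (fun _ h => h.1) 0, ncard_glue_eq W7 (fun _ h => h.1) 1,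
        ncard_glue_eq W8 (fun _ h => h.1) 1, ncard_glue_eq W7 (fun _ h => h.1) 2, ncard_glue_eq W8 (fun _ h => h.1) 2, hX3,
        show Nat.choose 4 0 = 1 by decide, show Nat.choose 4 1 = 4 by decide, show Nat.choose 4 2 = 6 by decide]
      ring
    rw [← hcount]
    exact ncard_le_ncard hsub hYfin
  -- (3) `#UF + #V8 ≤ #W8`, `#V7 ≤ #W7`
  have hUV : UF.ncard + V8.ncard ≤ W8.ncard := by
    have hdisj : Disjoint UF V8 := by
      rw [Set.disjoint_left]
      rintro A ⟨-, -, h6⟩ ⟨-, -, h7⟩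
      rw [h6] at h7
      have : (6 : ℕ) = 7 := by exact_mod_cast h7
      omega
    rw [← ncard_union_eq hdisj hUFfin hV8fin]
    exact ncard_le_ncard (union_subset (fun _ h => ⟨h.1, h.2.1⟩) (fun _ h => ⟨h.1, h.2.1⟩)) hW8fin
  have hV7W : V7.ncard ≤ W7.ncard := ncard_le_ncard (fun _ h => ⟨h.1, h.2.1⟩) hW7fin
  -- (4) C-025 at `(8, 6)` on `M ↾ F`: `8/7 · #UF ≤ #W7`
  have hrls' : (8 / 7 : ℚ) * (UF.ncard : ℚ) ≤ (W7.ncard : ℚ) := by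
    unfold ThmN.RLS at hrls
    rw [phiK_eight_six] at hrls
    have e1 : {A : Set α | A ⊆ (M ↾ F).E ∧ (M ↾ F).eRk A = ((8 : ℕ) : ℕ∞) ∧
        (M ↾ F).eRk ((M ↾ F).E \ A) = ((6 : ℕ) : ℕ∞)} = UF := by
      ext A
      simp only [hUF, mem_setOf_eq, Matroid.restrict_ground_eq]
      constructor
      · rintro ⟨h1, h2, h3⟩
        rw [M.restrict_eRk_eq h1] at h2
        rw [M.restrict_eRk_eq sdiff_subset] at h3
        exact ⟨h1, h2, h3⟩
      · rintro ⟨h1, h2, h3⟩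
        exact ⟨h1, by rwa [M.restrict_eRk_eq h1], by rwa [M.restrict_eRk_eq sdiff_subset]⟩
    have e2 : {A : Set α | A ⊆ (M ↾ F).E ∧ ((6 : ℕ) : ℕ∞) < (M ↾ F).eRk A ∧ (M ↾ F).eRk A < ((8 : ℕ) : ℕ∞)} = W7 := by
      ext A
      simp only [hW7, mem_setOf_eq, Matroid.restrict_ground_eq]
      constructor
      · rintro ⟨h1, h2, h3⟩
        refine ⟨h1, ?_⟩
        rw [M.restrict_eRk_eq h1] at h2 h3
        obtain ⟨r, hr, -⟩ := hrkF h1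
        rw [hr] at h2 h3 ⊢
        have h2' : 6 < r := by exact_mod_cast h2
        have h3' : r < 8 := by exact_mod_cast h3
        exact_mod_cast (show r = 7 by omega)
      · rintro ⟨h1, h2⟩
        refine ⟨h1, ?_, ?_⟩
        · rw [M.restrict_eRk_eq h1, h2]; exact_mod_cast (by norm_num : (6 : ℕ) < 7)
        · rw [M.restrict_eRk_eq h1, h2]; exact_mod_cast (by norm_num : (7 : ℕ) < 8)
    rw [e1, e2] at hrls
    exact hrls
  -- (5) the arithmetic
  have hUq : (Matroid.topCount M 11 7 : ℚ) ≤ 4 * (UF.ncard : ℚ) + (V8.ncard : ℚ) + (V7.ncard : ℚ) := by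
    exact_mod_cast hU
  have hYq : 11 * (W8.ncard : ℚ) + 10 * (W7.ncard : ℚ) ≤ (Matroid.midCount M 11 7 : ℚ) := by
    exact_mod_cast hY
  have hUVq : (UF.ncard : ℚ) + (V8.ncard : ℚ) ≤ (W8.ncard : ℚ) := by exact_mod_cast hUV
  have hV7Wq : (V7.ncard : ℚ) ≤ (W7.ncard : ℚ) := by exact_mod_cast hV7W
  have hV8nn : (0 : ℚ) ≤ (V8.ncard : ℚ) := by positivity
  linarith

/-- **THE SAME, UNCONDITIONAL**: the `(8, 6)` hypothesis is the level-6 row `c025_six_all` on `M ↾ F`. -/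
theorem s7lp_11_of_maxflat8' : (77 / 18 : ℚ) * (Matroid.topCount M 11 7 : ℚ) ≤ (Matroid.midCount M 11 7 : ℚ) := by
  haveI : (M ↾ F).Finite := Matroid.restrict_finite (M.ground_finite.subset hF)
  exact s7lp_11_of_maxflat8 hM hcol hF hFr hFn (ThmN.c025_six_all (M ↾ F) 8 le_rfl)

end Reduction

end S4Ups

end PercRepro
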